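import Summits.SmoothPoincare4.SmoothPoincare4.Theorems.CongruenceShadowsGriffithsHandlebodyExtensionCoverPlanarA
import HarnessLib

/-!
# SmoothPoincare4 / CongruenceShadows — `GriffithsHandlebodyExtension` (item stmt-SmoothPoincare4-15190): the planar family (E3), B.1 — continuity and the circle embedding

Support file (`--supports` stmt-SmoothPoincare4-15190) of the homothety-cover proof of the genus-one
clause (E) of Griffiths' handlebody extension theorem — *every self-diffeomorphism of the Heegaard torus
`∂V` of the round solid torus fixing the base point and acting trivially on `π₁(∂V)` extends to a
self-diffeomorphism of `V`* (hypothesis `hE` of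
`Literature.Topology.FourManifolds.RoundSolidTorusModel.diffeoExtends_of_map_ker_eq_ker_of_forall_diffeoExtends`).
See the module docstring of `…CoverDefs` for the whole line (E1–E6) and the notation
(`τ̂`, `δ_λ`, `ρ`, `χ`, `f`, `Δ^(c)`, `α`, `L`, `M`, `Ψ̂`, `ẽ_c`).

This part (E3-B, first half): global continuity of `τ`, `τ'` (equivariance at the origin), injectivity of the
derivative of `τ` off the origin, the smooth embedding `τ|_{S¹}` of the unit circle, and smooth left inverses of
equidimensional smooth embeddings.
-/

-- the registered namespace `Summit.SmoothPoincare4.SmoothPoincare4.Theorems` repeats a component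
set_option linter.dupNamespace false

noncomputable section

namespace Summit.SmoothPoincare4.SmoothPoincare4.Theorems

namespace HomothetyCover

open Set Function Metric Filter
open scoped Topology ContDiff

namespace Planar

open Set Function Metric Filter
open scoped Topology ContDiff Manifold
open Literature.Topology.FourManifolds
attribute [local instance] factFinrankE2
variable {lam : ℝ} (P : PI lam)

section Base

variable {lam : ℝ} (P : PI lam)

namespace PI

/-! ### B0. Continuity of `τ`, `τ'` at the origin -/

/-- `τ̂` commutes with the powers `δ_λ^n`. -/
theorem τ_pow_smul (n : ℕ) (y : E2) : P.τ (lam ^ n • y) = lam ^ n • P.τ y := by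
  induction n with
  | zero => simp
  | succ n ih => rw [pow_succ', mul_smul, P.τ_smul, ih, mul_smul]

/-- The inverse `τ̂'` is `δ_λ`-equivariant as well. -/
theorem τ'_smul (w : E2) : P.τ' (lam • w) = lam • P.τ' w := by
  apply P.τ_injective; rw [P.τ_τ', P.τ_smul, P.τ_τ']

/-- `τ̂'` commutes with the powers `δ_λ^n`. -/
theorem τ'_pow_smul (n : ℕ) (y : E2) : P.τ' (lam ^ n • y) = lam ^ n • P.τ' y := by
  induction n with
  | zero => simp
  | succ n ih => rw [pow_succ', mul_smul, P.τ'_smul, ih, mul_smul]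

/-- An equivariant map of the plane, continuous off the origin and fixing it, is continuous at
the origin (bounded on the compact fundamental annulus). -/
theorem continuousAt_zero_of_equivariant (hlam : 1 < lam) {f : E2 → E2} (hf0 : f 0 = 0)
    (hcont : ∀ y, y ≠ 0 → ContinuousAt f y) (hsmul : ∀ (n : ℕ) (y : E2), f (lam ^ n • y) = lam ^ n • f y) :
    ContinuousAt f 0 := by
  have hl : 0 < lam := lt_trans zero_lt_one hlam
  have hA : IsCompact (closedBall (0 : E2) lam ∩ {y | 1 ≤ ‖y‖}) :=
    (isCompact_closedBall _ _).inter_right (isClosed_le continuous_const continuous_norm)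
  have hc : ContinuousOn (fun y => ‖f y‖) (closedBall (0 : E2) lam ∩ {y | 1 ≤ ‖y‖}) := by
    intro y hy
    have hy0 : y ≠ 0 := by
      intro h; have := hy.2; simp only [h, mem_setOf_eq, norm_zero] at this; norm_num at this
    exact (hcont y hy0).norm.continuousWithinAt
  obtain ⟨B, hB⟩ := hA.exists_bound_of_continuousOn hc
  set B' := max B 1 with hB'
  have hB'pos : 0 < B' := lt_of_lt_of_le zero_lt_one (le_max_right _ _)
  have hbound : ∀ Y : E2, 1 ≤ ‖Y‖ → ‖Y‖ ≤ lam → ‖f Y‖ ≤ B' := fun Y h1 h2 => by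
    have h := hB Y ⟨by simpa using h2, h1⟩
    rw [Real.norm_eq_abs, abs_of_nonneg (norm_nonneg _)] at h
    exact h.trans (le_max_left _ _)
  rw [ContinuousAt, hf0, Metric.tendsto_nhds_nhds]
  intro ε hε
  obtain ⟨N, hN⟩ := pow_unbounded_of_one_lt (B' / ε) hlam
  have hlamN : 0 < lam ^ N := pow_pos hl N
  refine ⟨(lam ^ N)⁻¹, inv_pos.2 hlamN, fun Y hY => ?_⟩
  rw [dist_zero_right] at hY
  rw [dist_zero_right]
  by_cases hY0 : Y = 0
  · rw [hY0, hf0, norm_zero]; exact hε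
  have hnY : 0 < ‖Y‖ := norm_pos_iff.2 hY0
  have hle1 : ‖Y‖ < 1 := lt_of_lt_of_le hY (inv_le_one_of_one_le₀ (one_le_pow₀ hlam.le))
  have hx : 1 ≤ ‖Y‖⁻¹ := (one_le_inv₀ hnY).2 hle1.le
  obtain ⟨n, hn1, hn2⟩ := exists_nat_pow_near hx hlam
  set Z : E2 := lam ^ (n + 1) • Y with hZ
  have hnZ : ‖Z‖ = lam ^ (n + 1) * ‖Y‖ := by
    rw [hZ, norm_smul, Real.norm_eq_abs, abs_of_pos (pow_pos hl _)]
  have hZ1 : 1 ≤ ‖Z‖ := by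
    rw [hnZ]
    have := mul_lt_mul_of_pos_right hn2 hnY
    rw [inv_mul_cancel₀ hnY.ne'] at this
    exact this.le
  have hZ2 : ‖Z‖ ≤ lam := by
    rw [hnZ, pow_succ]
    have h := mul_le_mul_of_nonneg_right hn1 hnY.le
    rw [inv_mul_cancel₀ hnY.ne'] at h
    nlinarith
  have hfZ : ‖f Z‖ = lam ^ (n + 1) * ‖f Y‖ := by
    rw [hZ, hsmul, norm_smul, Real.norm_eq_abs, abs_of_pos (pow_pos hl _)]
  have hb := hbound Z hZ1 hZ2
  rw [hfZ] at hb
  have hNn : lam ^ N < lam ^ (n + 1) := by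
    have : (lam ^ N) < ‖Y‖⁻¹ := by rwa [lt_inv_comm₀ hlamN hnY]
    exact this.trans hn2
  have hpos : 0 < lam ^ (n + 1) := pow_pos hl _
  have h1 : ‖f Y‖ ≤ B' / lam ^ (n + 1) := by rw [le_div_iff₀ hpos]; linarith
  have h2 : B' / lam ^ (n + 1) < B' / lam ^ N := div_lt_div_of_pos_left hB'pos hlamN hNn
  have h3 : B' / lam ^ N < ε := by
    rw [div_lt_iff₀ hlamN]; have := hN; rw [div_lt_iff₀ hε] at this; linarith
  linarith

/-- `τ` is continuous on the whole plane (equivariance forces continuity at the origin). -/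
theorem continuous_τ (hlam : 1 < lam) : Continuous P.τ := by
  rw [continuous_iff_continuousAt]
  intro y
  by_cases hy : y = 0
  · subst hy
    exact continuousAt_zero_of_equivariant hlam P.τ_zero (fun y hy => (P.contDiffAt_τ y hy).continuousAt)
      P.τ_pow_smul
  · exact (P.contDiffAt_τ y hy).continuousAt

/-- `τ'` is continuous on the whole plane. -/
theorem continuous_τ' (hlam : 1 < lam) : Continuous P.τ' := by
  rw [continuous_iff_continuousAt]
  intro y
  by_cases hy : y = 0
  · subst hy
    exact continuousAt_zero_of_equivariant hlam P.τ'_zero (fun y hy => (P.contDiffAt_τ' y hy).continuousAt)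
      P.τ'_pow_smul
  · exact (P.contDiffAt_τ' y hy).continuousAt

/-! ### B1. `τ|S¹` is a smooth embedding of the circle -/

/-- The derivative of `τ` is injective off the origin (`τ' ∘ τ = id`). -/
theorem injective_fderiv_τ {y : E2} (hy : y ≠ 0) : Injective (fderiv ℝ P.τ y) := by
  have h1 : HasFDerivAt P.τ (fderiv ℝ P.τ y) y :=
    ((P.contDiffAt_τ y hy).differentiableAt (by simp)).hasFDerivAt
  have h2 : HasFDerivAt P.τ' (fderiv ℝ P.τ' (P.τ y)) (P.τ y) :=
    ((P.contDiffAt_τ' _ (P.τ_ne_zero hy)).differentiableAt (by simp)).hasFDerivAt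
  have hc := h2.comp y h1
  have he : (P.τ' ∘ P.τ) = id := funext P.τ'_τ
  rw [he] at hc
  have hid := hc.unique (hasFDerivAt_id y)
  intro a b hab
  have := congrArg (fderiv ℝ P.τ' (P.τ y)) hab
  rw [← ContinuousLinearMap.comp_apply, ← ContinuousLinearMap.comp_apply, hid] at this
  exact this

/-- `τ` restricted to the unit circle is a smooth embedding `S¹ → ℝ²`. -/
theorem isSmoothEmbedding_τ_sphere :
    Manifold.IsSmoothEmbedding (𝓡 1) (𝓡 2) ∞ (fun u : sphere (0 : E2) 1 => P.τ u.1) := by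
  have hval : ContMDiff (𝓡 1) (𝓡 2) ∞ (Subtype.val : sphere (0 : E2) 1 → E2) := contMDiff_coe_sphere
  have hcont : ContMDiff (𝓡 1) (𝓡 2) ∞ (fun u : sphere (0 : E2) 1 => P.τ u.1) := fun u =>
    (P.contDiffAt_τ u.1 (ne_zero_of_mem_unit_sphere u)).contMDiffAt.comp u (hval u)
  refine isSmoothEmbedding_of_injective_of_injective_mfderiv hcont (by exact_mod_cast le_top)
    (fun a b h => Subtype.ext (P.τ_injective h)) fun u => ?_
  have hu : (u : E2) ≠ 0 := ne_zero_of_mem_unit_sphere u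
  rw [show (fun u : sphere (0 : E2) 1 => P.τ u.1) = P.τ ∘ Subtype.val from rfl,
    mfderiv_comp u ((P.contDiffAt_τ u.1 hu).contMDiffAt.mdifferentiableAt (by simp))
      ((hval u).mdifferentiableAt (by simp))]
  rw [mfderiv_eq_fderiv]
  exact (P.injective_fderiv_τ hu).comp (mfderiv_coe_sphere_injective u)

end PI

/-! ### B3. Equidimensional smooth embeddings of the plane: a smooth left inverse -/

/-- A smooth embedding `e : ℝ² → ℝ²` is a smooth map with a left inverse that is smooth at the
image points (it is a local diffeomorphism, `IsSmoothEmbedding.isLocalDiffeomorph_of_finrank_eq`). -/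
theorem exists_leftInverse_of_isSmoothEmbedding {e : E2 → E2}
    (he : Manifold.IsSmoothEmbedding (𝓡 2) (𝓡 2) ∞ e) :
    ContDiff ℝ ∞ e ∧ IsOpenMap e ∧ ∃ einv : E2 → E2, (∀ x, einv (e x) = x) ∧ ∀ x, ContDiffAt ℝ ∞ einv (e x) := by
  have hloc : IsLocalDiffeomorph (𝓡 2) (𝓡 2) ∞ e :=
    he.isLocalDiffeomorph_of_finrank_eq rfl
  have hsmooth : ContDiff ℝ ∞ e := contMDiff_iff_contDiff.1 he.contMDiff
  have hinj : Injective e := he.isEmbedding.injective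
  refine ⟨hsmooth, hloc.isLocalHomeomorph.isOpenMap, Function.invFun e, Function.leftInverse_invFun hinj, fun x => ?_⟩
  obtain ⟨Φ, hx, heq⟩ := hloc x
  have hex : e x = Φ x := heq hx
  -- `invFun e` agrees with `Φ.symm` near `e x`
  have htgt : Φ.target ∈ 𝓝 (e x) := by
    rw [hex]; exact Φ.open_target.mem_nhds (Φ.map_source hx)
  have hagree : Function.invFun e =ᶠ[𝓝 (e x)] Φ.symm := by
    filter_upwards [htgt] with y hy
    have h1 : Φ.symm y ∈ Φ.source := Φ.map_target hy
    have h2 : e (Φ.symm y) = y := by rw [heq h1]; exact Φ.right_inv hy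
    conv_lhs => rw [← h2]
    exact Function.leftInverse_invFun hinj _
  have hsymm : ContMDiffAt (𝓡 2) (𝓡 2) ∞ Φ.symm (e x) := by
    have := Φ.contMDiffOn_invFun
    rw [hex]
    exact this.contMDiffAt (Φ.open_target.mem_nhds (Φ.map_source hx))
  exact (contMDiffAt_iff_contDiffAt.1 hsymm).congr_of_eventuallyEq hagree

end Base

end Planar

end HomothetyCover

end Summit.SmoothPoincare4.SmoothPoincare4.Theorems

end
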